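import Literature.MathematicalPhysics.QuantumFieldTheory.Balaban1983to89.LatticeWordStokesLocal

/-!
# `Balaban1983to89.T4ForestGaugeSameRootBound` — [Balaban1985Variational] (16)–(18) p. 280 ∕ [Balaban1985RegularSpaces] (1.19) p. 79, the SAME-ROOT half of the
# axial-gauge smallness letter: in the gauge `σ(x) = 𝒰_U(path x)` of a rooted forest whose paths are lattice WALKS, a non-forest bond whose two ends hang from the
# same root reads the holonomy of a CLOSED word, hence is within `((|w₋| + 1 + |w₊|)²/4)·δ` of `1` when the plaquettes in the count box of that word are `δ`-small
# (the tree's located crude Stokes bound `LatticeWordStokesLocal.dist1_holAt_le_local`, BY NAME)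

statement-level skeleton of published theorems with citation tags; proofs where landed; nothing here is a claim about the Yang–Mills mass gap

WHY (cell `pub-ymgap`, width seat `pub-ymgap-dag-n12-w6` g1; node N12 = [B15]; brick B4′ of the seat's `Q2-DESIGN.md` §7; lane word dag-n12-c g18 «take both»).  The interior
letter `hL` of `B15Prop1MinimiserTowerAxialGauge` §6 asks `dist1 ((U^σ) b) ≤ …` for the input bonds of the towers in the tower-axial gauge `σ := fun x => holAt U (path x)`.  For a bond
`b = ⟨s, μ⟩` whose endpoints `s`, `s + e_μ` hang from ONE root `r` with paths `walk r w₋`, `walk r w₊`, `(U^σ)(b) = 𝒰(walk r w₋)·U(b)·𝒰(walk r w₊)⁻¹ = 𝒰_r(w₋ · (+e_μ) · w₊ᵒᵖ)`, a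
closed word when the words' net displacements are the true lattice offsets (`netDisp w₊ = netDisp w₋ + e_μ`, no wrapping); the located Stokes bound of ym3-torus-p2 does the rest.
Any `GaugeGroup`, any torus level; the forest itself (dag-n12-w3's `N12RootedForest*`) and the plaquette smallness of the minimiser on the towers ([III] (2.14)) stay hypotheses.

CONTENTS (theorems only; no `def`, no `instance`, no `sorry`).
* `holAt_walk_mul_bond_mul_inv_eq` — the loop identity `𝒰(walk r w₋)·U⟨s, μ⟩·𝒰(walk r w₊)⁻¹ = 𝒰(walk r (w₋ ++ (μ,+) :: wordRev w₊))`.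
* (private) `netDisp_loopWord_eq_zero`, `length_loopWord` — bookkeeping of that word.
* ★★ `dist1_holAt_bond_le_of_sameRoot` — the bound `≤ ((|w₋| + 1 + |w₊|)²/4)·δ` under the count-box plaquette hypothesis of `LatticeWordStokesLocal`.
* ★★ `dist1_gaugeAct_holAtGauge_le_of_sameRoot` — the same read at the gauge `σ x := holAt U (path x)` with `path s = walk r w₋`, `path (s + e_μ) = walk r w₊`.
* `netDisp_shift_eq_of_walkEnd` — NO WRAPPING FOR SHORT WORDS: the displacement hypothesis `netDisp w₊ = netDisp w₋ + e_μ` FOLLOWS from the two end-site equations when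
  `|w₋| + 1 + |w₊| <` the number of sites per direction; ★★ `dist1_holAt_bond_le_of_sameRoot_of_length_lt`, ★★ `dist1_gaugeAct_holAtGauge_le_of_sameRoot_of_length_lt` — the two
  bounds with that length hypothesis in place of the displacement one.
* ★ `exists_root_word_of_forest` — BRIDGE to the forest currency of `Summits/…/BalabanUVNodesN12RootedForest` ((F2) roots have the empty path ∧ (TREE) every non-root hangs from a
  parent by its last oriented step): every path IS a lattice walk `walk r w` from a root `r ∈ R`, ending at the site, with `|w| = |path x|`.

HONEST FRAMING: [folklore] lattice bookkeeping + one call of a landed theorem; the CORRIDOR (different-root) bonds and every estimate of Bałaban's are NOT here; count-neutral; N12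
NOT discharged; nothing continuum ∕ OS ∕ mass-gap ∕ Clay.
-/

noncomputable section

namespace Literature.MathematicalPhysics.QuantumFieldTheory.Balaban1983to89.T4ForestGaugeSameRootBound

open T4Continuum T4ReflectionCone
open LatticeWordStokesLocal (dist1_holAt_le_local)

variable {P : Params} {j : ℕ} {G : Type*} [GaugeGroup G]

/-- **THE LOOP IDENTITY**: `𝒰(walk r w₋)·U⟨s, μ⟩·𝒰(walk r w₊)⁻¹ = 𝒰_r(w₋ · (+e_μ) · w₊ᵒᵖ)` when `walk r w₋` ends at `s` and `walk r w₊` at `s + e_μ` (multiplicativity of parallel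
transport, `U(−Γ) = U(Γ)⁻¹`). [cite: Balaban1985Averaging, (7)-(9) pp.18-19] -/
theorem holAt_walk_mul_bond_mul_inv_eq (U : GaugeField P j G) (r s : Site P j) (μ : Fin P.d) (wm wp : List (Letter P.d))
    (hs : walkEnd r wm = s) (ht : walkEnd r wp = s.shift μ) :
    holAt U (walk r wm) * U ⟨s, μ⟩ * (holAt U (walk r wp))⁻¹ = holAt U (walk r (wm ++ (μ, true) :: wordRev wp)) := by
  rw [walk_append, holAt_append, hs]
  show _ = holAt U (walk r wm) * holAt U (⟨⟨s, μ⟩, true⟩ :: walk (s.shift μ) (wordRev wp))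
  rw [holAt_cons, ← ht, holAt_walk_wordRev]
  simp only [↓reduceIte, mul_assoc]

/-- The loop word has zero net displacement when the two words' displacements differ by `e_μ` (no wrapping). [folklore] -/
private theorem netDisp_loopWord_eq_zero {μ : Fin P.d} {wm wp : List (Letter P.d)}
    (hnet : ∀ ν, netDisp wm ν + (if μ = ν then 1 else 0) = netDisp wp ν) (ν : Fin P.d) :
    netDisp (wm ++ (μ, true) :: wordRev wp) ν = 0 := by
  rw [netDisp_append, netDisp_cons, netDisp_wordRev, ← hnet ν]
  simp only [↓reduceIte]
  ring

/-- The loop word has length `|w₋| + 1 + |w₊|`. [folklore] -/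
private theorem length_loopWord (μ : Fin P.d) (wm wp : List (Letter P.d)) :
    (wm ++ (μ, true) :: wordRev wp).length = wm.length + 1 + wp.length := by
  simp only [List.length_append, List.length_cons, wordRev, List.length_reverse, List.length_map]
  omega

/-- ★★ **THE SAME-ROOT BOND BOUND**: for `b = ⟨s, μ⟩` with root-to-endpoint words `w₋`, `w₊` (`walk r w₋` ends at `s`, `walk r w₊` at `s + e_μ`, displacements differing by `e_μ`) and
`δ ≥ 0`: if every plaquette `⟨walkEnd r u, a, b⟩` based in the COUNT BOX of the loop word (`u.count ≤ (w₋ (+e_μ) w₊ᵒᵖ).count`) is within `δ` of `1`, then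
`dist1 (𝒰(walk r w₋)·U(b)·𝒰(walk r w₊)⁻¹) ≤ ((|w₋| + 1 + |w₊|)²/4)·δ` — `LatticeWordStokesLocal.dist1_holAt_le_local` on the loop. [cite: Balaban1985Variational, (16)-(18) p.280; Balaban1985Averaging, (19)-(20) p.21] -/
theorem dist1_holAt_bond_le_of_sameRoot (U : GaugeField P j G) (r s : Site P j) (μ : Fin P.d) (wm wp : List (Letter P.d))
    (hs : walkEnd r wm = s) (ht : walkEnd r wp = s.shift μ) (hnet : ∀ ν, netDisp wm ν + (if μ = ν then 1 else 0) = netDisp wp ν)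
    {δ : ℝ} (hδ : 0 ≤ δ)
    (hloc : ∀ u : List (Letter P.d), (∀ l, u.count l ≤ (wm ++ (μ, true) :: wordRev wp).count l) →
      ∀ (a b : Fin P.d) (hab : a < b), dist1 (GaugeField.plaqHol U ⟨walkEnd r u, a, b, hab⟩) < δ) :
    dist1 (holAt U (walk r wm) * U ⟨s, μ⟩ * (holAt U (walk r wp))⁻¹) ≤ (((wm.length + 1 + wp.length : ℕ) : ℝ) ^ 2 / 4) * δ := by
  rw [holAt_walk_mul_bond_mul_inv_eq U r s μ wm wp hs ht, ← length_loopWord μ wm wp]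
  exact dist1_holAt_le_local U hδ r _ hloc (netDisp_loopWord_eq_zero hnet)

/-- ★★ **AT THE FOREST GAUGE `σ x := 𝒰_U(path x)`**: if `path s = walk r w₋` and `path (s + e_μ) = walk r w₊` as above, then the gauged bond variable `(U^σ)⟨s, μ⟩` is within
`((|w₋| + 1 + |w₊|)²/4)·δ` of `1` under the count-box hypothesis — the SAME-ROOT case of the interior letter of `B15Prop1MinimiserTowerAxialGauge` §6 ([15] (16)–(18): the axial gauge
`Ax_k(𝔅_k, U₀)` makes the bonds inside the towers near `1`). [cite: Balaban1985Variational, (16)-(18) p.280; Balaban1985RegularSpaces, (1.19) p.79] -/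
theorem dist1_gaugeAct_holAtGauge_le_of_sameRoot (U : GaugeField P j G) (path : Site P j → List (LStep P j)) (r s : Site P j) (μ : Fin P.d)
    (wm wp : List (Letter P.d)) (hps : path s = walk r wm) (hpt : path (s.shift μ) = walk r wp)
    (hs : walkEnd r wm = s) (ht : walkEnd r wp = s.shift μ) (hnet : ∀ ν, netDisp wm ν + (if μ = ν then 1 else 0) = netDisp wp ν)
    {δ : ℝ} (hδ : 0 ≤ δ)
    (hloc : ∀ u : List (Letter P.d), (∀ l, u.count l ≤ (wm ++ (μ, true) :: wordRev wp).count l) →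
      ∀ (a b : Fin P.d) (hab : a < b), dist1 (GaugeField.plaqHol U ⟨walkEnd r u, a, b, hab⟩) < δ) :
    dist1 (GaugeField.gaugeAct (fun x => holAt U (path x)) U ⟨s, μ⟩) ≤ (((wm.length + 1 + wp.length : ℕ) : ℝ) ^ 2 / 4) * δ := by
  show dist1 (holAt U (path s) * U ⟨s, μ⟩ * (holAt U (path (PBond.tgt ⟨s, μ⟩)))⁻¹) ≤ _
  rw [show (PBond.tgt ⟨s, μ⟩ : Site P j) = s.shift μ from rfl, hps, hpt]
  exact dist1_holAt_bond_le_of_sameRoot U r s μ wm wp hs ht hnet hδ hloc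

/-! ## No wrapping for short words; the bridge to the `(F2) + (TREE)` forest currency -/

/-- `-|w| ≤ netDisp w ν ≤ |w|`. [folklore] -/
private theorem netDisp_le_length {n : ℕ} (ν : Fin n) : ∀ w : List (Letter n), netDisp w ν ≤ (w.length : ℤ) ∧ -(w.length : ℤ) ≤ netDisp w ν
  | [] => by simp [netDisp]
  | l :: w => by
      have ih := netDisp_le_length ν w
      rw [netDisp_cons, List.length_cons]
      push_cast
      split_ifs <;> constructor <;> linarith [ih.1, ih.2]

/-- **NO WRAPPING FOR SHORT WORDS**: if `walk r w₋` ends at `s`, `walk r w₊` ends at `s + e_μ` and `|w₋| + 1 + |w₊| <` the number of sites per direction, then the integer displacements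
satisfy `netDisp w₊ = netDisp w₋ + e_μ` (the two sides agree modulo the period by `walkEnd_apply`, and differ by less than the period). (lattice bookkeeping). [cite: Balaban1985Averaging, (5)-(9) pp.18-19] -/
theorem netDisp_shift_eq_of_walkEnd (r s : Site P j) (μ : Fin P.d) (wm wp : List (Letter P.d)) (hs : walkEnd r wm = s) (ht : walkEnd r wp = s.shift μ)
    (hlen : wm.length + 1 + wp.length < P.sitesPerDir j) (ν : Fin P.d) :
    netDisp wm ν + (if μ = ν then 1 else 0) = netDisp wp ν := by
  have key : ((netDisp wp ν - (netDisp wm ν + (if μ = ν then 1 else 0)) : ℤ) : ZMod (P.sitesPerDir j)) = 0 := by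
    have h1 := walkEnd_apply r wm ν
    have h2 := walkEnd_apply r wp ν
    rw [hs] at h1
    rw [ht, Site.shift_apply] at h2
    by_cases hνμ : ν = μ
    · subst hνμ
      rw [if_pos rfl, h1] at h2
      rw [if_pos rfl]
      push_cast
      linear_combination -h2
    · rw [if_neg hνμ, h1] at h2
      rw [if_neg (Ne.symm hνμ)]
      push_cast
      linear_combination -h2
  rw [ZMod.intCast_zmod_eq_zero_iff_dvd] at key
  have hm := netDisp_le_length ν wm
  have hp := netDisp_le_length ν wp
  have hN : ((wm.length : ℤ) + 1 + wp.length) < (P.sitesPerDir j : ℤ) := by exact_mod_cast hlen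
  have habs : |netDisp wp ν - (netDisp wm ν + (if μ = ν then 1 else 0))| < (P.sitesPerDir j : ℤ) := by
    rw [abs_lt]
    split_ifs <;> constructor <;> linarith [hm.1, hm.2, hp.1, hp.2]
  have h0 := Int.eq_zero_of_abs_lt_dvd key habs
  linarith

/-- ★★ The same-root bond bound with the LENGTH hypothesis `|w₋| + 1 + |w₊| < #sites per direction` in place of the displacement one. [cite: Balaban1985Variational, (16)-(18) p.280; Balaban1985Averaging, (19)-(20) p.21] -/
theorem dist1_holAt_bond_le_of_sameRoot_of_length_lt (U : GaugeField P j G) (r s : Site P j) (μ : Fin P.d) (wm wp : List (Letter P.d))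
    (hs : walkEnd r wm = s) (ht : walkEnd r wp = s.shift μ) (hlen : wm.length + 1 + wp.length < P.sitesPerDir j)
    {δ : ℝ} (hδ : 0 ≤ δ)
    (hloc : ∀ u : List (Letter P.d), (∀ l, u.count l ≤ (wm ++ (μ, true) :: wordRev wp).count l) →
      ∀ (a b : Fin P.d) (hab : a < b), dist1 (GaugeField.plaqHol U ⟨walkEnd r u, a, b, hab⟩) < δ) :
    dist1 (holAt U (walk r wm) * U ⟨s, μ⟩ * (holAt U (walk r wp))⁻¹) ≤ (((wm.length + 1 + wp.length : ℕ) : ℝ) ^ 2 / 4) * δ :=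
  dist1_holAt_bond_le_of_sameRoot U r s μ wm wp hs ht (netDisp_shift_eq_of_walkEnd r s μ wm wp hs ht hlen) hδ hloc

/-- ★★ The forest-gauge edition with the LENGTH hypothesis in place of the displacement one. [cite: Balaban1985Variational, (16)-(18) p.280; Balaban1985RegularSpaces, (1.19) p.79] -/
theorem dist1_gaugeAct_holAtGauge_le_of_sameRoot_of_length_lt (U : GaugeField P j G) (path : Site P j → List (LStep P j)) (r s : Site P j) (μ : Fin P.d)
    (wm wp : List (Letter P.d)) (hps : path s = walk r wm) (hpt : path (s.shift μ) = walk r wp)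
    (hs : walkEnd r wm = s) (ht : walkEnd r wp = s.shift μ) (hlen : wm.length + 1 + wp.length < P.sitesPerDir j)
    {δ : ℝ} (hδ : 0 ≤ δ)
    (hloc : ∀ u : List (Letter P.d), (∀ l, u.count l ≤ (wm ++ (μ, true) :: wordRev wp).count l) →
      ∀ (a b : Fin P.d) (hab : a < b), dist1 (GaugeField.plaqHol U ⟨walkEnd r u, a, b, hab⟩) < δ) :
    dist1 (GaugeField.gaugeAct (fun x => holAt U (path x)) U ⟨s, μ⟩) ≤ (((wm.length + 1 + wp.length : ℕ) : ℝ) ^ 2 / 4) * δ :=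
  dist1_gaugeAct_holAtGauge_le_of_sameRoot U path r s μ wm wp hps hpt hs ht (netDisp_shift_eq_of_walkEnd r s μ wm wp hs ht hlen) hδ hloc

/-- ★ **BRIDGE TO THE FOREST CURRENCY** of `Summits/QuantumFields/YangMills/Theorems/BalabanUVNodesN12RootedForest` (`exists_rootedForest`: (F2) `path r = []` on the root set `R` ∧
(TREE) every `x ∉ R` hangs from a parent `x′` by its last ORIENTED step): every path is a lattice WALK from a root — `path x = walk r w` with `r ∈ R`, `walkEnd r w = x` and
`|w| = |path x|` (induction on `|path x|`; the last step `s` is the one-letter walk `(dir s, fwd s)` from the parent). (the axial gauge of a tree). [cite: Balaban1985RegularSpaces, (1.19) p.79] -/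
theorem exists_root_word_of_forest {R : Set (Site P j)} {path : Site P j → List (LStep P j)} (hroot : ∀ r ∈ R, path r = [])
    (htree : ∀ x, x ∉ R → ∃ (x' : Site P j) (s : LStep P j), path x = path x' ++ [s] ∧
      (s.fwd = true → s.bond.src = x' ∧ s.bond.tgt = x) ∧ (s.fwd = false → s.bond.src = x ∧ s.bond.tgt = x')) (x : Site P j) :
    ∃ r ∈ R, ∃ w : List (Letter P.d), path x = walk r w ∧ walkEnd r w = x ∧ w.length = (path x).length := by
  induction' hn : (path x).length using Nat.strong_induction_on with n ih generalizing x
  by_cases hxR : x ∈ R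
  · exact ⟨x, hxR, [], by rw [hroot x hxR]; rfl, rfl, by rw [← hn, hroot x hxR]; rfl⟩
  · obtain ⟨x', s, hpx, hfwd, hbwd⟩ := htree x hxR
    have hlt : (path x').length < n := by rw [← hn, hpx, List.length_append, List.length_singleton]; omega
    obtain ⟨r, hr, w', hpx', hend', hlen'⟩ := ih _ hlt x' rfl
    -- the last step as a one-letter walk from the parent `x′`
    obtain ⟨⟨src, dir⟩, fwd⟩ := s
    have hstep : [(⟨⟨src, dir⟩, fwd⟩ : LStep P j)] = walk x' [(dir, fwd)] ∧ walkEnd x' [(dir, fwd)] = x := by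
      cases fwd
      · obtain ⟨hsx, htx⟩ := hbwd rfl
        simp only [PBond.tgt] at hsx htx
        subst hsx
        have hux : x'.unshift dir = src := by
          rw [← htx]
          funext κ
          simp only [Site.shift_apply, Site.unshift_apply]
          by_cases h : κ = dir
          · subst h; simp
          · simp [h]
        simp only [walk, walkEnd, hux, and_self]
      · obtain ⟨hsx, htx⟩ := hfwd rfl
        simp only [PBond.tgt] at hsx htx
        subst hsx
        simp only [walk, walkEnd, htx, and_self]
    refine ⟨r, hr, w' ++ [(dir, fwd)], ?_, ?_, ?_⟩
    · rw [hpx, hpx', walk_append, hend', hstep.1]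
    · rw [walkEnd_append, hend', hstep.2]
    · rw [← hn, hpx, List.length_append, List.length_append, List.length_singleton, List.length_singleton, hlen']

end Literature.MathematicalPhysics.QuantumFieldTheory.Balaban1983to89.T4ForestGaugeSameRootBound

end
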